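import Summits.ResolutionOfSingularities.ResolutionOfSingularities.Theorems.MarkedTransferCampaignG1PnegaObligationF33StdIIFirst
import HarnessLib

/-!
# [OURS · L1 G1 ℘nega-INTERFACE / G2 R05] Obligation F3.3 under «II-first» — the ORDER BOUND `ord H♭(ϵ(0)) ≥ q` in every case
# (sharp), and the remaining data-level cell PW ✗. By res-type-063 (gen 7); companion of `…F33StdIIFirst` (p505890); carried by res-L1-type-o6.

CARRIER NOTE (res-L1-type-o6 g18): KERNEL by res-type-063 (HOME draft `D/res-type-063/PnegaObligationF33StdIIFirstCells.draft.lean` sha16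
991e0aea8c8fc88e, DRAFT READY + CARRY ask 2026-08-27T06:44:07Z, TAKING 06:47Z), summit-side VERBATIM (this note added). [OURS · L1 G1]
replaces the role of: nothing printed beyond what the decl docstrings cite — data-level kernels giving the OURS-corrected order bound
`ord H♭(ϵ(0)) ≥ q` for the «II-first» reading of the retyped obligation F3.3 and the cell PW ✗ (R05 / Def. 9.12 order-clause reading
material for res-adj-2); NOT a statement of the manuscript.
HONEST FRAMING. Nothing here is a statement of H. Hironaka's manuscript *Resolution of singularities in positive characteristics*
(2017-03-23, [Hironaka2017], lit key `paper:url-3343fd9e678b`; every printed item is a CANDIDATE [claim: Hironaka2017, status: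
under-review]). Kernel theorems about OURS objects (`HFlatDatum` p496649, row 057/057b `HFlat.caseI` / `HFlat.selectIIFirst`, res-type-087's
`PowerWitness.tilde`). AI kernel work, weaker than expert review; nothing here is progress on resolution of singularities in positive characteristic.

## What is proved (completion placement `K'[[x]]`, `K'` a field of characteristic `p`, `p` prime; NO order clause)
* `le_order_of_isSupportedOnMultiples` — a series supported on `qℕ^n` with zero constant term has order `≥ q`.
* `HFlatDatum.q_le_order_hasseDeriv_top` — if `|α+pβ| ≤ q` then `ord ∂^{(α+pβ)}ϵ(0) ≥ q` (Eq. (79) lattice support,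
  `HFlatDatum.isSupportedOnMultiples_hasseDeriv_top` p503719, + `coeff_{α+pβ}ϵ(0) = 0` from §8.3 (1) `q < ord ϵ(0)`); the naive bound is `≥ 1`.
  (Compare res-type-058's `TopDeriv.le_order_hasseDeriv_topExp`, p504952: `≥ q·d` under «every top-block exponent has |c_t| ≥ d» — here no
  top-block hypothesis, the vanishing constant term does the work.)
* `HFlatDatum.q_le_adicOrder_caseI_value` — **Case (I) outside (II): `ord H♭(ϵ(0)) ≥ q`**, the OURS-corrected form of Rem. 9.9 (1)'s order
  claim (as printed «≥ ord ϵ(0)», refuted by res-adj-2's W2 witness: `ord H♭ = 2 = q < ord ϵ = 4` — so `q` is SHARP).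
* `HFlatDatum.q_le_adicOrder_value_of_selectIIFirst` — **under «II-first», `ord H♭(ϵ(0)) ≥ q = ord g` in EVERY case** (II: `≥ ord ϵ(0)` via
  `x^{α+pβ}`; I outside II: previous item; III: `> q`, `…F33StdIIFirst`): the OURS-corrected reading of Def. 9.12's clause «with orders
  ≥ ord_ξ(ϵ)» (p.51 L31, typed `U51_2`) that DOES hold for the II-first operator — with `q` in place of `ord ϵ(0)`.
* `CaseIIIDatum.not_F33std_RIIfirstShape_powerWitness` — cell «PW × F3.3[II-first]» = ✗ at `(K[[y,z]], 𝔪^·)`, every `e ≥ 1`, every `m`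
  (the Case-(III) datum is selected by II-first, `CaseIIIDatum.datum_case_eq_selectIIFirst`; its value `z^{p+1}` is not a `p^e`-th power).
  With `…F33StdReadings` (✗ bypass / F6d-elt / F3⁻) and `…F33StdIIFirst` (✓ jacWitness) the II-first column has every computed cell of the
  ORDER column except SW (res-D-pv-031's cylinder datum, Case-(I)-only, decides SW for every reading when it lands).
No `def`s (kernel file).
-/

noncomputable section

set_option linter.dupNamespace false -- mandated namespace of this single-conjunct summit

namespace Summit.ResolutionOfSingularities.ResolutionOfSingularities.Theorems.Campaign.PnegaObligation.CaseIIIDatum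

open Literature.AlgebraicGeometry.Hironaka2017 Literature.AlgebraicGeometry.Hironaka2017.S09LLUED

universe u

/-- «II-first» reading: «PW × F3.3» = ✗ at the placement of record (every `e ≥ 1`, `m`). NOT a statement of the manuscript. [folklore] -/
theorem not_F33std_RIIfirstShape_powerWitness (K : Type u) [Field K] (p : ℕ) [Fact p.Prime] [CharP K p]
    [CharP (MvPowerSeries (Fin 2) K) p] {e : ℕ} (he : 1 ≤ e) (m : ℕ) :
    ¬ ∀ d : HFlatDatum p K 2 (mPow K), d.case = HFlat.selectIIFirst p d.q d.α d.β d.γ₀ d.lem96 → d.degree < 0 →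
        d.value ∈ PowerWitness.tilde p e (mPow K) m d.degree := by
  intro h
  have hmem := h (datum K p) (datum_case_eq_selectIIFirst K p) (by rw [datum_degree]; norm_num)
  rw [datum_value, datum_degree] at hmem
  exact eps0_not_mem_powerWitness_tilde K p he m 1 Nat.one_pos (by simpa using hmem)

end Summit.ResolutionOfSingularities.ResolutionOfSingularities.Theorems.Campaign.PnegaObligation.CaseIIIDatum

namespace Summit.ResolutionOfSingularities.ResolutionOfSingularities.Theorems.Campaign.PnegaObligation

open Literature.AlgebraicGeometry.Hironaka2017 Literature.AlgebraicGeometry.Hironaka2017.S09LLUED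
open Literature.RingTheory.MvPowerSeries (hasseDeriv constantCoeff_hasseDeriv adicOrder_eq_order IsSupportedOnMultiples)
open Literature.AlgebraicGeometry.Resolution (adicOrder)
open MvPowerSeries (X coeff)

universe v

section CaseIOrder

variable {K' : Type v} [Field K'] {n : ℕ} {p : ℕ} [Fact p.Prime] [CharP K' p] {P : ℕ → Ideal (MvPowerSeries (Fin n) K')}

/-- A series supported on `q`-multiples with zero constant term has order `≥ q` (`q ≥ 1`). [folklore] -/
theorem le_order_of_isSupportedOnMultiples {q : ℕ} {ψ : MvPowerSeries (Fin n) K'} (hψ : IsSupportedOnMultiples q ψ)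
    (h0 : MvPowerSeries.constantCoeff ψ = 0) : ((q : ℕ) : ℕ∞) ≤ ψ.order := by
  refine MvPowerSeries.nat_le_order fun m hm => ?_
  by_cases hm0 : m = 0
  · rw [hm0, MvPowerSeries.coeff_zero_eq_constantCoeff_apply, h0]
  · obtain ⟨i, hi⟩ := Finsupp.support_nonempty_iff.mpr hm0
    refine hψ m ⟨i, fun hdvd => ?_⟩
    have hle : m i ≤ m.degree := Finsupp.le_degree i m
    have hpos : 0 < m i := Nat.pos_of_ne_zero (Finsupp.mem_support_iff.mp hi)
    exact absurd (Nat.le_of_dvd hpos hdvd) (by omega)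

/-- **Outside Case (II) the top derivative has order `≥ q`**: `|α+pβ| ≤ q < ord ϵ(0)` ⇒ `ord ∂^{(α+pβ)}ϵ(0) ≥ q`, because by Eq. (79)
`∂^{(α+pβ)}ϵ(0)` is supported on `qℕ^n` (`isSupportedOnMultiples_hasseDeriv_top`, p503719) and its constant term `coeff_{α+pβ}ϵ(0)` vanishes.
(The naive bound is only `ord ϵ(0) − |α+pβ| ≥ 1`.) NOT a statement of the manuscript. [folklore] -/
theorem HFlatDatum.q_le_order_hasseDeriv_top (d : HFlatDatum p K' n P) (hθ : (d.α + p • d.β).degree ≤ d.q) :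
    ((d.q : ℕ) : ℕ∞) ≤ (hasseDeriv (d.α + p • d.β) d.ε0).order := by
  refine le_order_of_isSupportedOnMultiples d.isSupportedOnMultiples_hasseDeriv_top ?_
  rw [constantCoeff_hasseDeriv]
  have hord : ((d.q : ℕ) : ℕ∞) < d.ε0.order := by
    have h := d.std.ord_lt; rw [adicOrder_eq_order] at h; exact h
  exact MvPowerSeries.coeff_of_lt_order (lt_of_le_of_lt (by exact_mod_cast hθ) hord)

/-- **Case (I) outside (II): `ord H♭(ϵ(0)) ≥ q`** — the OURS-corrected order bound for the Case-(I) recipe `u₀⁻¹ ∂^{(α+pβ)}ϵ(0)·∂^{(qγ₀)}ϵ(0)`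
when `|α+pβ| ≤ q` (what holds in place of Rem. 9.9 (1) «≥ ord ϵ(0)», which res-adj-2's W2 witness refutes as printed: there `ord H♭ = 2 = q <
ord ϵ = 4`, so the bound `q` is SHARP). NOT a statement of the manuscript. [folklore] -/
theorem HFlatDatum.q_le_adicOrder_caseI_value (d : HFlatDatum p K' n P) (hθ : (d.α + p • d.β).degree ≤ d.q) :
    ((d.q : ℕ) : ℕ∞) ≤ adicOrder (HFlat.caseI (hasseFamily K' n) d.u₀ p d.q d.α d.β d.γ₀ d.ε0) := by
  rw [adicOrder_eq_order]
  unfold HFlat.caseI hasseFamily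
  have h := d.q_le_order_hasseDeriv_top hθ
  exact le_trans h (le_trans le_add_self (le_trans MvPowerSeries.le_order_mul (le_trans le_self_add MvPowerSeries.le_order_mul)))

/-- **Under «II-first», `ord H♭(ϵ(0)) ≥ q` in EVERY case** (Case (II): `≥ ord ϵ(0) > q` by `x^{α+pβ}`; Case (I) is taken only outside (II):
previous theorem; Case (III): `≥ ord ϵ(0) > q`, `…F33StdIIFirst`); hence every «II-first» value lies in `𝔪^q`. NOT a statement of the
manuscript. [folklore] -/
theorem HFlatDatum.q_le_adicOrder_value_of_selectIIFirst (d : HFlatDatum p K' n P)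
    (hsel : d.case = HFlat.selectIIFirst p d.q d.α d.β d.γ₀ d.lem96) : ((d.q : ℕ) : ℕ∞) ≤ adicOrder d.value := by
  have hord : ((d.q : ℕ) : ℕ∞) < d.ε0.order := by
    have h := d.std.ord_lt; rw [adicOrder_eq_order] at h; exact h
  unfold HFlatDatum.value
  rw [hsel]
  unfold HFlat.selectIIFirst
  by_cases h2 : d.q < (d.α + p • d.β).degree
  · rw [dif_pos h2]
    show ((d.q : ℕ) : ℕ∞) ≤ adicOrder (HFlat.caseII X (hasseFamily K' n) p d.α d.β d.ε0)
    rw [adicOrder_eq_order]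
    unfold HFlat.caseII hasseFamily
    refine le_trans ?_ (MvPowerSeries.le_order_mul)
    rw [order_mono_X]
    refine le_trans (le_of_lt hord) ?_
    have h := Literature.RingTheory.MvPowerSeries.order_le_order_hasseDeriv_add_degree (d.α + p • d.β) d.ε0
    rw [add_comm] at h
    exact h
  · rw [dif_neg h2]
    by_cases h1 : 2 * d.q ≤ (d.q • d.γ₀).degree
    · rw [dif_pos h1]
      exact d.q_le_adicOrder_caseI_value (not_lt.mp h2)
    · rw [dif_neg h1]
      exact le_of_lt (d.q_lt_adicOrder_caseIII_value ((d.lem96.resolve_left h1).resolve_left h2))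

end CaseIOrder

end Summit.ResolutionOfSingularities.ResolutionOfSingularities.Theorems.Campaign.PnegaObligation
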